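import Summits.QuantumFields.BalabanUV.Beta.D1BFx.TorusMassiveResolvent
import Summits.QuantumFields.BalabanUV.Beta.BorderedHessianKernelAction

/-!
# `BalabanUV.Beta.D1BFx.TorusHodgeWeight` — road «BF-x» (binder row D1, slot (K)), `K-ASSEMBLY-SPEC-v2.md` §2 row K-TB3b, brick «K-TB3b-H»:
# **THE HODGE WEIGHT ON THE TORUS** — in the sorted currency `ν = I 3 (m+1) p` of every coarse torus, `2•X̂(0) = K̂ + 2•(ĝrad·(1 − P̂)·ĝradᵀ)|_ν`:
# the WEIGHT `B̂₀ := 2•X̂(0) − K̂` of the N-side of the slice-transfer identity IS twice the periodised kernel of `dz∘Rf∘codiff₁` (`Rf = id − Pf`)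

HONEST FRAMING (cell contract, verbatim): «discharging `BetaPertH` makes Bałaban's UV stability UNCONDITIONAL — a real constructive-QFT
result; it is NOT the continuum limit and NOT the Clay problem.»  HONEST DEPENDENCY (verbatim): «continuum YM on T⁴ ⇐ BetaPertH ∧ nine
spine estimates (0/9 proved); BetaPertH ⇐ (D1) ∧ (D4) ∧ CAP+tail; G-an2-4 gates asym, D1 and NE2/3/4.»  THIS MODULE DISCHARGES NOTHING of
D1 / BetaPertH: [folklore] finite stencil algebra + an4's periodisation product rule over the cell's typed objects BY NAME (gan24-leaf-06-g28's
`HodgeIdentityForms.curvAdj_curv_apply` ∕ `StencilKernels`; the road owner's `X1aKer`, `gaugeF`, `Xhat`, `TorusMassiveResolvent`; `PeriodisedProjector.Phat`∕`Lhat`;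
an2-g13's `bhK` (`bhK_inl_inl_eq`, `decays_bhK`, `shiftK_bhK`); leaf-03-g8's `Khat`, `fTL_sortK`, `e₁`, `periodiseF_reblock_eq_submatrix`).  Seven [our object]
data `def`s with bodies (`gradDivF`, `RgaugeF`, `RgaugeM`, `ccF`, `Dhat`, `DhatS`, `RGhat` — kernels ∕ matrices); no `def … : Prop`; nothing cited; 0 sorry.
0∕4 row-D1 binders; (K) NOT closed; NOT summit progress; NOT BetaPertH, NOT continuum, NOT Clay.
ABSOLUTE RULE (cell, verbatim): «No internally-minted statement may enter as a cited fact. Every hypothesis is either kernel-proved in this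
package or a verbatim quotation of a PUBLISHED theorem with page reference. The manuscript(s) under audit are NOT citable for their own
disputed steps — they are the thing under adjudication; programme-internal (2001/route/tribunal) claims are never citable.»

WHY (spec §0 DECISION 2, §2 row K-TB3b «`B̂₀ = 2•X̂(0) − Khat` is `(reblock n (2·RgaugeM))^`», v2.1 «to be CHECKED»; owner's FILE 2 §4, journal l.22310).
TB1's M-side fine operator is `K̂ = (curvAdj∘curv)^`; the leg `Ga` inverts `½·curvAdj∘curv + dz∘Rf∘codiff₁ + (a∕n⁸)𝒬ᵀ𝒬` (X₁a), so the N-side operator is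
`2•X̂(0)`.  The lattice Hodge identity `curvAdj (curv A) = 2•codiff₁∘dz − 2•dz∘codiff₁` gives ENTRYWISE ON `ℤ⁴` `2·X1aKer₀ = (d*d kernel) + 2·(dz∘codiff₁ − dz∘Pf∘codiff₁ kernel)`;
an4's product rule on the fine torus turns the right-hand kernel into `ĝrad·(1 − P̂)·ĝradᵀ` and `SortedEmbedding.e₁` transports it to `ν`.  So FILE 2's junction
`K̂ + τ′₀ᵀA₀τ′₀ = 2•X̂(0)` REDUCES to its §3 (`1 − P̂ = L̂N(NᵀL̂²N)⁻¹NᵀL̂`, gan24-leaf-01's `ColumnSpaceProjector` over leaf-03's `Nhat`) via `two_smul_Xhat_zero_sub_Khat`.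
CONTENT (`0 < a` enters only through `Pker`'s periodicity ∕ row bound): §1 `gradDivF` (kernel of `dz∘codiff₁`; `Kfib_gradDivF`, `dz_codiff₁_eq_sum_tsum`), `RgaugeF`∕`RgaugeM`
(kernel of `dz∘Rf∘codiff₁`), `ccF n := toF (blk (bhK n) true true)`; §2 **`two_mul_X1aKer_zero`** (`2·X1aKer₀ = ccF + 2·RgaugeF`, pure algebra); §3 `Dhat D s` (THE REAL FINE-TORUS
GRADIENT MATRIX), `periodiseF_gradDivF∕gaugeF∕RgaugeF` (`= Dhat·Dhatᵀ`, `Dhat·P̂·Dhatᵀ`, `Dhat·(1 − P̂)·Dhatᵀ`), `two_smul_periodiseF_X1aKer_zero`; §4 `RGhat`, `DhatS := Dhat.submatrix e₁ id`,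
`RGhat_eq_DhatS`, `Xhat_eq_submatrix`, `Khat_eq_submatrix`, THE END **`two_smul_Xhat_zero : 2•X̂(0) = K̂ + 2•RGhat`**, **`two_smul_Xhat_zero_sub_Khat : 2•X̂(0) − K̂ = 2•(DhatS·(1 − P̂)·DhatSᵀ)`**;
§5 **`Dhat_transpose_mul_Dhat : Dhatᵀ·Dhat = L̂`**, `DhatS_transpose_mul_DhatS` (the `ĝradᵀĝrad = L̂` of FILE 2 §2).
NOT HERE: `PiHat`∕`What0`∕`Nhat` (FILE 1), `tauP`∕`Amat`∕`Rhat_eq` (FILE 2 §1–§3 ∕ K-TB3b-GEN), the jets (TB4), the ghost side (K-TB3a∕c), TB5.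
Provenance: G-an2-4 formalisation swarm, unit `b2b-balaban-gan24-formalise-leaf-06` (gen 31), cross-lane brick «K-TB3b-H» for road «BF-x», 2026-08-20.
-/


noncomputable section

namespace Summit.QuantumFields.BalabanUV.Beta.D1BFx.TorusHodgeWeight

open Matrix Finset
open scoped BigOperators
open Literature.MathematicalPhysics.QuantumFieldTheory.Balaban1983to89
open Literature.MathematicalPhysics.QuantumFieldTheory.Balaban1983to89.Beta
open ExpKernelCalculus (MKer shiftK)
open AffineAveraging (Form0 Form1 unitVec dz curv curvAdj codiff₁)
open KKTFluctuationKernel (delta1 delta1_apply)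
open B6QGQLower276 (X lapKer)
open Summit.QuantumFields.BalabanUV.Beta.BorderedHessian (bhK bhK_inl_inl_eq decays_bhK)
open Summit.QuantumFields.BalabanUV.Beta.D1BFx.FibredPeriodisation (FKer Kfib Kfib_apply periodiseF periodiseF_apply periodiseF_add
  periodiseF_const_mul periodise₂_finset_sum isPeriodic₂_compKer rowBound_compKer summable_abs_compKer periodise₂_compKer_matrix periodise₂_transpose)
open Summit.QuantumFields.BalabanUV.Beta.D1BFx.PeriodicArrays (toF toF_apply Kfib_toF)
open Summit.QuantumFields.BalabanUV.Beta.D1BFx.SortedReblocking (reblock imageShift_mul_eq_add summable_abs_row)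
open Summit.QuantumFields.BalabanUV.Beta.D1BFx.SortedPack (fTL_sortK)
open Summit.QuantumFields.BalabanUV.Beta.D1BFx.SortedEmbedding (e₁ periodiseF_reblock_eq_submatrix)
open Summit.QuantumFields.BalabanUV.Beta.D1BFx.SortedRelInv (shiftK_bhK)
open Summit.QuantumFields.BalabanUV.Beta.D1BFx.PackedKernelSplit (blk)
open Summit.QuantumFields.BalabanUV.Beta.D1BFx.TorusCombKKT (I Khat)
open Summit.QuantumFields.BalabanUV.Beta.D1BFx.StencilKernels (dzKer codiffKer codiffKer_eq_dzKer_swap isPeriodic₂_dzKer isPeriodic₂_codiffKer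
  summable_dzKer_row summable_codiffKer_row dz_eq_tsum_dzKer codiff₁_eq_sum_tsum_codiffKer codiff₁_dz_eq_tsum_lapKer)
open Summit.QuantumFields.BalabanUV.Beta.D1BFx.StencilDictionaryEntries (lapF)
open Summit.QuantumFields.BalabanUV.Beta.D1BFx.PeriodisedKernels (isPeriodic₂_Pker rowBound_Pker summable_abs_row_Pker)
open Summit.QuantumFields.BalabanUV.Beta.D1BFx.PeriodisedProjector (Phat Phat_apply Lhat Lhat_apply)
open Summit.QuantumFields.BalabanUV.Beta.D1BFx.RProjector (Pker)
open Summit.QuantumFields.BalabanUV.Beta.D1BFx.VectorLegKernelForm (X1aKer)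
open Summit.QuantumFields.BalabanUV.Beta.D1BFx.VectorPropagatorImages (gaugeF compKer_dzKer_Pker_codiffKer Kfib_X1aKer summable_Kfib_X1aKer
  rowBound_codiffKer)
open Summit.QuantumFields.BalabanUV.Beta.D1BFx.TorusBorderedResolvent (X1aM toF_X1aM Xhat)
open Summit.QuantumFields.BalabanUV.Beta.D1BFx.TorusMassiveResolvent (isPeriodic₂_Kfib_gaugeF isPeriodic₂_X1aM summable_X1aM_row)
open Summit.QuantumFields.BalabanUV.Beta.D1BFx.HodgeIdentityForms (curvAdj_curv_apply)

/-! ## §1 The `ℤ^d` kernels: `dz∘codiff₁`, `dz∘Rf∘codiff₁`, and the `d*d` entry -/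

section Lattice
variable {d : ℕ}

/-- [our object] **THE KERNEL OF `dz ∘ codiff₁`** (gradient of the divergence) on 1-forms of `ℤ^d`, fibre second:
`gradDivF ((x,κ)) ((y,l)) := codiffKer l (x + e_κ) y − codiffKer l x y` `= 𝟙[y = x+e_κ−e_l] − 𝟙[y = x+e_κ] − 𝟙[y = x−e_l] + 𝟙[y = x]`. -/
def gradDivF : FKer d (Fin d) (Fin d) := fun i j => codiffKer j.2 (i.1 + unitVec i.2) j.1 - codiffKer j.2 i.1 j.1

/-- [our object] The four indicators of `gradDivF`. -/
theorem gradDivF_apply (x y : X d) (κ l : Fin d) : gradDivF (x, κ) (y, l) = ((if y = x + unitVec κ - unitVec l then (1 : ℝ) else 0)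
    - (if y = x + unitVec κ then 1 else 0)) - ((if y = x - unitVec l then (1 : ℝ) else 0) - (if y = x then 1 else 0)) := rfl

/-- [folklore] **`Kfib gradDivF κ l = dzKer κ ∘ codiffKer l`** as `ℤ^d` kernels (`dz` is the row action of `dzKer`). -/
theorem Kfib_gradDivF (κ l : Fin d) : Kfib (gradDivF (d := d)) κ l = compKer (dzKer κ) (codiffKer l) := by
  funext x y
  rw [Kfib_apply, compKer, ← dz_eq_tsum_dzKer (fun q => codiffKer l q y) κ x]
  rfl

/-- [folklore] A `codiffKer`-row against any function is summable (two non-zero terms). -/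
theorem summable_codiffKer_mul (l : Fin d) (x : X d) (g : X d → ℝ) : Summable fun w => codiffKer l x w * g w := by
  refine summable_of_ne_finset_zero (s := ({x - unitVec l, x} : Finset (X d))) fun w hw => ?_
  simp only [Finset.mem_insert, Finset.mem_singleton, not_or] at hw
  simp only [codiffKer, if_neg hw.1, if_neg hw.2, sub_self, zero_mul]

/-- [folklore] **`dz ∘ codiff₁` IS THE ROW ACTION OF `gradDivF`**: `dz (codiff₁ A) κ x = Σ_l Σ'_y gradDivF (x,κ) (y,l) · A l y` for EVERY 1-form `A`
(finitely many non-zero terms; no growth condition). -/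
theorem dz_codiff₁_eq_sum_tsum (A : Form1 d ℝ) (κ : Fin d) (x : X d) :
    dz (codiff₁ A) κ x = ∑ l, ∑' y : X d, gradDivF (x, κ) (y, l) * A l y := by
  show codiff₁ A (x + unitVec κ) - codiff₁ A x = _
  rw [codiff₁_eq_sum_tsum_codiffKer, codiff₁_eq_sum_tsum_codiffKer, ← Finset.sum_sub_distrib]
  refine Finset.sum_congr rfl fun l _ => ?_
  rw [← (summable_codiffKer_mul l _ _).tsum_sub (summable_codiffKer_mul l _ _)]
  exact tsum_congr fun y => by rw [gradDivF]; ring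

/-- [folklore] The fibres of `gradDivF` are jointly `s`-periodic for every `s` (translation-invariant stencils). -/
theorem isPeriodic₂_Kfib_gradDivF (s : ℕ) (κ l : Fin d) : IsPeriodic₂ s (Kfib (gradDivF (d := d)) κ l) := by
  rw [Kfib_gradDivF]
  exact isPeriodic₂_compKer (isPeriodic₂_dzKer κ s) (isPeriodic₂_codiffKer l s)

/-- [folklore] A row of `Σ'_r g r · delta1 l y κ r` picks out `g y` on the fibre diagonal. -/
theorem tsum_mul_delta1 (g : (Fin (d + 1) → ℤ) → ℝ) (l κ : Fin (d + 1)) (y : Fin (d + 1) → ℤ) :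
    ∑' r, g r * delta1 l y κ r = if κ = l then g y else 0 := by
  by_cases h : κ = l
  · rw [if_pos h, tsum_eq_single y (fun r hr => by rw [delta1_apply, if_neg (fun hc => hr hc.2), mul_zero]), delta1_apply, if_pos ⟨h, rfl⟩, mul_one]
  · rw [if_neg h, tsum_congr (fun r => by rw [delta1_apply, if_neg (fun hc => h hc.1), mul_zero]), tsum_zero]

end Lattice

section Road
variable (m : ℕ) (a : ℝ)

/-- [our object] **THE KERNEL OF `dz ∘ Rf ∘ codiff₁` AT BLOCK SIDE `m+1`** (`Rf = id − Pf`, `KernelFormOperators`; `Pf`'s kernel word is the owner's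
four-point `gaugeF m a`): `RgaugeF m a := gradDivF − gaugeF m a` — the spec's `RgaugeM`, fibre second. -/
def RgaugeF : FKer 4 (Fin 4) (Fin 4) := fun i j => gradDivF i j - gaugeF m a i j

/-- [our object] The `MKer` reading of `RgaugeF` (so that TA1's `reblock` applies): `RgaugeM m a x y κ l := RgaugeF m a (x,κ) (y,l)`. -/
def RgaugeM : MKer 4 (Fin 4) := fun x y κ l => RgaugeF m a (x, κ) (y, l)

/-- [our object] `toF` undoes the reading. -/
theorem toF_RgaugeM : toF (RgaugeM m a) = RgaugeF m a := rfl

/-- [our object] Entries of `RgaugeF`. -/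
theorem RgaugeF_apply (i j : X 4 × Fin 4) : RgaugeF m a i j = gradDivF i j - gaugeF m a i j := rfl

/-- [our object] **THE `d*d` ENTRY AS A FIBRED KERNEL**: `ccF n := toF (blk (bhK n) true true)` — the ff block of an2-g13's undressed bordered Hessian
(`= K̂`'s `ℤ⁴` kernel, `TorusCombKKT.Khat` ∕ `SortedPack.fTL_sortK`). -/
def ccF (n : ℕ) : FKer 4 (Fin 4) (Fin 4) := toF (blk (bhK (d := 3) n) true true)

/-- [folklore] `ccF n (x,κ) (y,l) = (d*d δ_{(l,y)})_κ(x)` (`bhK_inl_inl_eq`: the window of `bhK`'s ff entry is redundant). -/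
theorem ccF_apply (n : ℕ) (x y : X 4) (κ l : Fin 4) : ccF n (x, κ) (y, l) = curvAdj (curv (delta1 l y)) κ x :=
  bhK_inl_inl_eq n x y κ l

/-! ## §2 The Hodge weight on `ℤ⁴` -/

/-- [folklore] X₁a's kernel at weight `0`, entrywise: the fibre-diagonal Laplacian minus the four-point gauge word. -/
theorem X1aKer_zero_apply (x y : X 4) (κ l : Fin 4) :
    X1aKer (m + 1) a 0 (x, κ) (y, l) = (if κ = l then lapKer x y else 0) - gaugeF m a (x, κ) (y, l) := by
  have h := Kfib_X1aKer (m := m) (a := a) 0 κ l x y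
  simp only [Kfib_apply, zero_mul, add_zero] at h
  exact h

/-- [folklore] The `d*d` entry through the Hodge identity: `(d*d δ_{(l,y)})_κ(x) = 2·𝟙[κ = l]·lapKer x y − 2·gradDivF (x,κ) (y,l)`. -/
theorem ccF_eq_hodge (n : ℕ) (x y : X 4) (κ l : Fin 4) :
    ccF n (x, κ) (y, l) = 2 * (if κ = l then lapKer x y else 0) - 2 * gradDivF (x, κ) (y, l) := by
  rw [ccF_apply, curvAdj_curv_apply, codiff₁_dz_eq_tsum_lapKer, dz_codiff₁_eq_sum_tsum]
  have h1 : ∑' r : X 4, lapKer x r * delta1 l y κ r = if κ = l then lapKer x y else 0 := tsum_mul_delta1 (d := 3) (lapKer x) l κ y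
  have h2 : ∑ l', ∑' r : X 4, gradDivF (x, κ) (r, l') * delta1 l y l' r = gradDivF (x, κ) (y, l) := by
    rw [Finset.sum_congr rfl fun l' _ => tsum_mul_delta1 (d := 3) (fun r => gradDivF (x, κ) (r, l')) l l' y, Finset.sum_ite_eq' Finset.univ l,
      if_pos (Finset.mem_univ l)]
  rw [h1, h2]
  simp only [nsmul_eq_mul, Nat.cast_ofNat]

/-- [folklore] **THE HODGE WEIGHT ON `ℤ⁴`**: `2·X1aKer (m+1) a 0 (x,κ) (y,l) = ccF (m+1) (x,κ) (y,l) + 2·RgaugeF m a (x,κ) (y,l)` — twice X₁a's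
weight-`0` kernel is the `d*d` kernel plus twice the kernel of `dz∘Rf∘codiff₁` (an2's Hodge normalisation `curvAdj∘curv = 2·δd`; pure algebra, every `m`, `a`). -/
theorem two_mul_X1aKer_zero (x y : X 4) (κ l : Fin 4) :
    2 * X1aKer (m + 1) a 0 (x, κ) (y, l) = ccF (m + 1) (x, κ) (y, l) + 2 * RgaugeF m a (x, κ) (y, l) := by
  rw [X1aKer_zero_apply, ccF_eq_hodge, RgaugeF_apply]
  ring

/-- [folklore] The same as an identity of fibred kernels. -/
theorem two_mul_X1aKer_zero_eq : (fun i j => 2 * X1aKer (m + 1) a 0 i j) = ccF (m + 1) + fun i j => 2 * RgaugeF m a i j := by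
  funext ⟨x, κ⟩ ⟨y, l⟩; rw [Pi.add_apply, Pi.add_apply]; exact two_mul_X1aKer_zero m a x y κ l

/-! ## §3 The Hodge weight on the fine torus `Site 4 s`, `s = (m+1)·p` -/

/-- [our object] **THE REAL FINE-TORUS GRADIENT MATRIX** `Dhat D s : Matrix (Site D s × Fin D) (Site D s) ℝ`, `((x,κ), z) ↦ periodise₂ s (dzKer κ) x z`
(= `(m+1)⁻¹·GradOp` entrywise, `StencilDictionaryEntries.GradOp_entry_site`; rows = fine bonds, columns = fine sites). -/
def Dhat (D s : ℕ) [NeZero s] : Matrix (Site D s × Fin D) (Site D s) ℝ := Matrix.of fun i z => periodise₂ s (dzKer (d := D) i.2) i.1 z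

/-- [our object] Entries of `Dhat`. -/
theorem Dhat_apply {D : ℕ} (s : ℕ) [NeZero s] (x : Site D s) (κ : Fin D) (z : Site D s) :
    Dhat D s (x, κ) z = periodise₂ s (dzKer κ) x z := rfl

/-- [folklore] **`Dhatᵀ` IS THE PERIODISED CODIFFERENTIAL**: `(Dhat D s)ᵀ z (y,l) = periodise₂ s (codiffKer l) z y` (`codiffKer = dzKerᵀ` + an4's transpose rule). -/
theorem Dhat_transpose_apply {D : ℕ} (s : ℕ) [NeZero s] (z y : Site D s) (l : Fin D) :
    (Dhat D s)ᵀ z (y, l) = periodise₂ s (codiffKer l) z y := by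
  rw [Matrix.transpose_apply, Dhat_apply]
  have e : (fun p q => codiffKer (d := D) l q p) = dzKer l := by
    funext p q; exact codiffKer_eq_dzKer_swap l q p
  rw [← e, periodise₂_transpose (isPeriodic₂_codiffKer l s)]

variable {a} (p : ℕ) [NeZero p]

/-- [folklore] Rows of the fibres of `gradDivF` are summable. -/
theorem summable_Kfib_gradDivF (κ l : Fin 4) (x : X 4) : Summable (Kfib (gradDivF (d := 4)) κ l x) := by
  rw [Kfib_gradDivF]
  exact (summable_abs_compKer (summable_dzKer_row κ x).abs (rowBound_codiffKer l)).1.of_abs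

/-- [folklore] Rows of the fibres of the four-point gauge kernel are summable (`0 < a`). -/
theorem summable_Kfib_gaugeF (ha : 0 < a) (κ l : Fin 4) (x : X 4) : Summable (Kfib (gaugeF m a) κ l x) := by
  rw [← compKer_dzKer_Pker_codiffKer]
  exact (summable_abs_compKer (summable_dzKer_row κ x).abs (rowBound_compKer (rowBound_Pker m ha) (rowBound_codiffKer l))).1.of_abs

/-- [folklore] Rows of the fibres of `RgaugeF` are summable (`0 < a`). -/
theorem summable_Kfib_RgaugeF (ha : 0 < a) (κ l : Fin 4) (x : X 4) : Summable (Kfib (RgaugeF m a) κ l x) :=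
  ((summable_Kfib_gradDivF κ l x).sub (summable_Kfib_gaugeF m ha κ l x)).congr fun y => by simp only [Kfib_apply, RgaugeF_apply]

/-- [folklore] The fibres of `RgaugeF` are jointly `s`-periodic for `m+1 ∣ s` (`0 < a`). -/
theorem isPeriodic₂_Kfib_RgaugeF (ha : 0 < a) {s : ℕ} (hdiv : m + 1 ∣ s) (κ l : Fin 4) : IsPeriodic₂ s (Kfib (RgaugeF m a) κ l) := by
  intro x y t
  have h1 := isPeriodic₂_Kfib_gradDivF (d := 4) s κ l x y t
  have h2 := isPeriodic₂_Kfib_gaugeF m ha hdiv κ l x y t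
  simp only [Kfib_apply] at h1 h2
  simp only [Kfib_apply, RgaugeF_apply, h1, h2]

/-- [folklore] Rows of the ff block of `bhK (m+1)` are summable (finite range of `d*d`, `decays_bhK`). -/
theorem summable_bhK_ff_row (κ l : Fin 4) (x : X 4) : Summable fun x' => blk (bhK (d := 3) (m + 1)) true true x x' κ l :=
  (summable_abs_row (decays_bhK (d := 3) (N := m + 1) (Nat.le_add_left 1 m) zero_le_one) one_pos x (Sum.inl κ) (Sum.inl l)).of_abs

/-- [folklore] The same, read as the fibres of `ccF (m+1)`. -/
theorem summable_Kfib_ccF (κ l : Fin 4) (x : X 4) : Summable (Kfib (ccF (m + 1)) κ l x) := summable_bhK_ff_row m κ l x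

/-- [folklore] The ff block of `bhK (m+1)` is jointly `s`-periodic in its lattice variables for `m+1 ∣ s` (block covariance `shiftK_bhK`). -/
theorem isPeriodic₂_bhK_ff {s : ℕ} (hdiv : m + 1 ∣ s) (κ l : Fin 4) : IsPeriodic₂ s (fun x x' => blk (bhK (d := 3) (m + 1)) true true x x' κ l) := by
  obtain ⟨q, hq⟩ := hdiv
  subst hq
  intro x y t
  show bhK (m + 1) (imageShift ((m + 1) * q) x t) (imageShift ((m + 1) * q) y t) (Sum.inl κ) (Sum.inl l) = bhK (m + 1) x y (Sum.inl κ) (Sum.inl l)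
  rw [imageShift_mul_eq_add, imageShift_mul_eq_add]
  have e := shiftK_bhK (d := 3) (N := m + 1) ((q : ℤ) • t)
  exact congrFun (congrFun (congrFun (congrFun e x) y) (Sum.inl κ)) (Sum.inl l)

/-- [folklore] **`(gradDivF)^ = Dhat · Dhatᵀ`** on every fine torus (an4's product rule; `dzKer` rows finitely supported, `codiffKer` periodic with row bound `2`). -/
theorem periodiseF_gradDivF (s : ℕ) [NeZero s] : Matrix.of (periodiseF s (gradDivF (d := 4))) = Dhat 4 s * (Dhat 4 s)ᵀ := by
  ext ⟨x, κ⟩ ⟨y, l⟩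
  have h := periodise₂_compKer_matrix (s := s) (fun x => (summable_dzKer_row (d := 4) κ x).abs) (isPeriodic₂_codiffKer l s) (rowBound_codiffKer l)
  have hxy := congr_fun (congr_fun h x) y
  rw [Matrix.of_apply, Matrix.mul_apply] at hxy
  rw [Matrix.of_apply, periodiseF_apply, Kfib_gradDivF, hxy, Matrix.mul_apply]
  exact Finset.sum_congr rfl fun z _ => by rw [Matrix.of_apply, Matrix.of_apply, Dhat_apply, Dhat_transpose_apply]

/-- [folklore] **`(gaugeF m a)^ = Dhat · P̂ · Dhatᵀ`** on the fine torus `Site 4 ((m+1)·p)` — the owner's `gauge_sandwich_entry` in REAL matrix form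
(`P̂ = PeriodisedProjector.Phat m a ((m+1)·p)`; two product rules; `0 < a`). -/
theorem periodiseF_gaugeF (ha : 0 < a) :
    Matrix.of (periodiseF ((m + 1) * p) (gaugeF m a))
      = Dhat 4 ((m + 1) * p) * Phat m a ((m + 1) * p) * (Dhat 4 ((m + 1) * p))ᵀ := by
  have hdiv : m + 1 ∣ (m + 1) * p := ⟨p, rfl⟩
  ext ⟨x, κ⟩ ⟨y, l⟩
  have hin : Matrix.of (periodise₂ ((m + 1) * p) (compKer (Pker m a) (codiffKer l)))
      = Matrix.of (periodise₂ ((m + 1) * p) (Pker m a)) * Matrix.of (periodise₂ ((m + 1) * p) (codiffKer (d := 4) l)) :=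
    periodise₂_compKer_matrix (summable_abs_row_Pker m ha) (isPeriodic₂_codiffKer l _) (rowBound_codiffKer l)
  have hout : Matrix.of (periodise₂ ((m + 1) * p) (compKer (dzKer κ) (compKer (Pker m a) (codiffKer l))))
      = Matrix.of (periodise₂ ((m + 1) * p) (dzKer (d := 4) κ))
          * Matrix.of (periodise₂ ((m + 1) * p) (compKer (Pker m a) (codiffKer l))) :=
    periodise₂_compKer_matrix (fun x => (summable_dzKer_row κ x).abs)
      (isPeriodic₂_compKer (isPeriodic₂_Pker m ha hdiv) (isPeriodic₂_codiffKer l _))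
      (rowBound_compKer (rowBound_Pker m ha) (rowBound_codiffKer l))
  have hxy := congr_fun (congr_fun hout x) y
  rw [Matrix.of_apply, hin, ← Matrix.mul_assoc] at hxy
  rw [Matrix.of_apply, periodiseF_apply, ← compKer_dzKer_Pker_codiffKer, hxy]; simp only [Matrix.mul_apply, Matrix.of_apply, Dhat_apply, Phat_apply, Dhat_transpose_apply]

/-- [folklore] **`(RgaugeF m a)^ = Dhat · (1 − P̂) · Dhatᵀ`** on the fine torus `Site 4 ((m+1)·p)` — THE PERIODISED KERNEL OF `dz∘Rf∘codiff₁` IS THE GRADIENT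
SANDWICH OF THE COMPLEMENTARY PROJECTOR `R̂ = 1 − P̂` (`0 < a`). -/
theorem periodiseF_RgaugeF (ha : 0 < a) :
    Matrix.of (periodiseF ((m + 1) * p) (RgaugeF m a))
      = Dhat 4 ((m + 1) * p) * (1 - Phat m a ((m + 1) * p)) * (Dhat 4 ((m + 1) * p))ᵀ := by
  have e : RgaugeF m a = gradDivF + fun i j => (-1 : ℝ) * gaugeF m a i j := by
    funext i j; rw [Pi.add_apply, Pi.add_apply, RgaugeF_apply]; ring
  have hG : ∀ κ l x, Summable (Kfib (fun i j => (-1 : ℝ) * gaugeF m a i j) κ l x) := fun κ l x =>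
    ((summable_Kfib_gaugeF m ha κ l x).mul_left (-1)).congr fun y => by simp only [Kfib_apply]
  rw [Matrix.mul_sub, Matrix.sub_mul, Matrix.mul_one, ← periodiseF_gradDivF, ← periodiseF_gaugeF m p ha]
  ext i j
  rw [Matrix.sub_apply, Matrix.of_apply, Matrix.of_apply, Matrix.of_apply, e, periodiseF_add summable_Kfib_gradDivF hG,
    periodiseF_const_mul]
  ring

/-- [folklore] **THE HODGE WEIGHT ON THE FINE TORUS**: `2•(X1aKer (m+1) a 0)^ = (ccF (m+1))^ + 2•(Dhat·(1 − P̂)·Dhatᵀ)` on `Site 4 ((m+1)·p) × Fin 4` (`0 < a`). -/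
theorem two_smul_periodiseF_X1aKer_zero (ha : 0 < a) :
    (2 : ℝ) • Matrix.of (periodiseF ((m + 1) * p) (X1aKer (m + 1) a 0))
      = Matrix.of (periodiseF ((m + 1) * p) (ccF (m + 1)))
          + (2 : ℝ) • (Dhat 4 ((m + 1) * p) * (1 - Phat m a ((m + 1) * p)) * (Dhat 4 ((m + 1) * p))ᵀ) := by
  rw [← periodiseF_RgaugeF m p ha]
  have hR : ∀ κ l x, Summable (Kfib (fun i j => (2 : ℝ) * RgaugeF m a i j) κ l x) := fun κ l x =>
    ((summable_Kfib_RgaugeF m ha κ l x).mul_left 2).congr fun y => by simp only [Kfib_apply]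
  ext i j
  rw [Matrix.smul_apply, Matrix.of_apply, Matrix.add_apply, Matrix.of_apply, Matrix.smul_apply, Matrix.of_apply, smul_eq_mul, smul_eq_mul,
    ← periodiseF_const_mul, ← periodiseF_const_mul, two_mul_X1aKer_zero_eq, periodiseF_add (summable_Kfib_ccF m) hR]

/-! ## §4 The Hodge weight in the sorted currency `ν = I 3 (m+1) p` -/

/-- [our object] **`RGhat`** — the torus matrix, in the sorted currency over the coarse torus `Site 4 p`, of the kernel of `dz∘Rf∘codiff₁`:
`(reblock (m+1) (RgaugeM m a))^`.  Half the weight: `B̂₀ = 2•X̂(0) − K̂ = 2•RGhat` (`two_smul_Xhat_zero_sub_Khat`). -/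
def RGhat (m : ℕ) (a : ℝ) (p : ℕ) [NeZero p] : Matrix (I 3 (m + 1) p) (I 3 (m + 1) p) ℝ :=
  Matrix.of (periodiseF p (reblock (m + 1) (RgaugeM m a)))

/-- [our object] **`DhatS`** — THE SORTED FINE-TORUS GRADIENT: the rows of `Dhat 4 ((m+1)·p)` re-indexed to `ν = I 3 (m+1) p` by `SortedEmbedding.e₁`
(columns stay fine torus sites).  K-TB3b FILE 1's `What0 = ĝrad·Nhat` reads `What0 = DhatS·Nhat`; FILE 2's `tauP = Nhatᵀ·L̂·DhatSᵀ`. -/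
def DhatS : Matrix (I 3 (m + 1) p) (Site 4 ((m + 1) * p)) ℝ := (Dhat 4 ((m + 1) * p)).submatrix (e₁ (m + 1) p) id

/-- [folklore] **`RGhat = (Dhat·(1 − P̂)·Dhatᵀ).submatrix e₁ e₁`** — the sorted-currency weight is the fine-torus gradient sandwich re-indexed (`0 < a`). -/
theorem RGhat_eq_submatrix (ha : 0 < a) :
    RGhat m a p = (Dhat 4 ((m + 1) * p) * (1 - Phat m a ((m + 1) * p)) * (Dhat 4 ((m + 1) * p))ᵀ).submatrix (e₁ (m + 1) p) (e₁ (m + 1) p) := by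
  rw [RGhat, periodiseF_reblock_eq_submatrix (K := RgaugeM m a) (fun κ l => isPeriodic₂_Kfib_RgaugeF m ha ⟨p, rfl⟩ κ l)
    (fun κ l x => summable_Kfib_RgaugeF m ha κ l x), toF_RgaugeM, periodiseF_RgaugeF m p ha]

/-- [folklore] **`RGhat = DhatS · (1 − P̂) · DhatSᵀ`** — THE SOCKET FOR K-TB3b FILE 2 §4: with `tauP := Nhatᵀ·L̂·DhatSᵀ`, `Amat := 2•(Nhatᵀ·L̂·L̂·Nhat)⁻¹` and
`Rhat_eq : 1 − P̂ = L̂·Nhat·(Nhatᵀ·L̂·L̂·Nhat)⁻¹·Nhatᵀ·L̂`, `tauPᵀ·Amat·tauP = 2•RGhat` is three rewrites. -/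
theorem RGhat_eq_DhatS (ha : 0 < a) : RGhat m a p = DhatS m p * (1 - Phat m a ((m + 1) * p)) * (DhatS m p)ᵀ := by
  rw [RGhat_eq_submatrix m p ha, DhatS, Matrix.transpose_submatrix,
    Matrix.submatrix_mul _ _ (e₁ (m + 1) p) id (e₁ (m + 1) p) Function.bijective_id,
    Matrix.submatrix_mul _ _ (e₁ (m + 1) p) id id Function.bijective_id, Matrix.submatrix_id_id]

/-- [folklore] **`X̂(a′) = ((X1aKer (m+1) a a′)^).submatrix e₁ e₁`** — the owner's `Xhat` is the fine-torus periodisation of X₁a's kernel re-indexed (`0 < a`). -/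
theorem Xhat_eq_submatrix (ha : 0 < a) (a' : ℝ) :
    Xhat m a p a' = (Matrix.of (periodiseF ((m + 1) * p) (X1aKer (m + 1) a a'))).submatrix (e₁ (m + 1) p) (e₁ (m + 1) p) := by
  rw [Xhat, periodiseF_reblock_eq_submatrix (isPeriodic₂_X1aM m ha ⟨p, rfl⟩ a') (summable_X1aM_row m ha a'), toF_X1aM]

/-- [folklore] **`K̂ = ((ccF (m+1))^).submatrix e₁ e₁`** — leaf-03-g8's `Khat` is the fine-torus periodisation of the `d*d` kernel re-indexed (every `a`; no decay input
beyond `decays_bhK`). -/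
theorem Khat_eq_submatrix :
    Khat (d := 3) (m + 1) p = (Matrix.of (periodiseF ((m + 1) * p) (ccF (m + 1)))).submatrix (e₁ (m + 1) p) (e₁ (m + 1) p) := by
  rw [Khat, fTL_sortK, periodiseF_reblock_eq_submatrix (fun κ l => isPeriodic₂_bhK_ff m ⟨p, rfl⟩ κ l) (fun κ l x => summable_bhK_ff_row m κ l x)]
  rfl

/-- [folklore] **THE HODGE WEIGHT ON THE TORUS (sorted currency)**: `2•X̂(0) = K̂ + 2•RGhat` on every coarse torus `Site 4 p`, every block side `m+1`,
every `a > 0` — the N-side fine operator of the slice-transfer identity is the M-side one plus twice the periodised kernel of `dz∘Rf∘codiff₁`. -/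
theorem two_smul_Xhat_zero (ha : 0 < a) : (2 : ℝ) • Xhat m a p 0 = Khat (d := 3) (m + 1) p + (2 : ℝ) • RGhat m a p := by
  rw [Xhat_eq_submatrix m p ha 0, Khat_eq_submatrix, RGhat_eq_submatrix m p ha]
  have h := two_smul_periodiseF_X1aKer_zero m p ha
  ext i j
  have hij := congr_fun (congr_fun h (e₁ (m + 1) p i)) (e₁ (m + 1) p j)
  simpa only [Matrix.smul_apply, Matrix.add_apply, Matrix.submatrix_apply] using hij

/-- [folklore] **THE WEIGHT `B̂₀ := 2•X̂(0) − K̂ = 2•(DhatS·(1 − P̂)·DhatSᵀ)`** — K-ASSEMBLY-SPEC v2 §2 row K-TB3b's first clause («`B̂₀` is `(reblock n (2·RgaugeM))^`»)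
and the v2.1 check «`B̂₀ = 2•X̂(0) − Khat`», in the form FILE 2 §4 consumes. -/
theorem two_smul_Xhat_zero_sub_Khat (ha : 0 < a) :
    (2 : ℝ) • Xhat m a p 0 - Khat (d := 3) (m + 1) p = (2 : ℝ) • (DhatS m p * (1 - Phat m a ((m + 1) * p)) * (DhatS m p)ᵀ) := by
  rw [two_smul_Xhat_zero m p ha, add_sub_cancel_left, RGhat_eq_DhatS m p ha]

/-! ## §5 `ĝradᵀ·ĝrad = L̂`: the gradient matrix squares to the periodised scalar Laplacian -/

/-- [folklore] **`Σ_κ codiffKer κ ∘ dzKer κ = lapKer`** as `ℤ^d` kernels (`codiff₁∘dz = −Δ`, `StencilKernels.codiff₁_dz_eq_tsum_lapKer`, read on an indicator). -/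
theorem sum_compKer_codiffKer_dzKer {d : ℕ} (x y : X d) : ∑ κ, compKer (codiffKer κ) (dzKer κ) x y = lapKer x y := by
  classical
  set f : X d → ℝ := fun q => if q = y then 1 else 0 with hf
  have hR : ∑' w : X d, lapKer x w * f w = lapKer x y := by
    rw [tsum_eq_single y (fun w hw => by rw [hf]; simp only; rw [if_neg hw, mul_zero]), hf]
    simp only [if_true, mul_one]
  have hdz : ∀ κ w, dz f κ w = dzKer κ w y := by
    intro κ w
    rw [dz_eq_tsum_dzKer, tsum_eq_single y (fun q hq => by rw [hf]; simp only; rw [if_neg hq, mul_zero]), hf]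
    simp only [if_true, mul_one]
  have h := codiff₁_dz_eq_tsum_lapKer f x
  rw [hR, codiff₁_eq_sum_tsum_codiffKer] at h
  rw [← h]
  refine Finset.sum_congr rfl fun κ _ => ?_
  simp only [compKer, hdz]

/-- [folklore] Function-level form: `lapKer = Σ_κ codiffKer κ ∘ dzKer κ`. -/
theorem lapKer_eq_sum_compKer {d : ℕ} : (lapKer : X d → X d → ℝ) = fun x y => ∑ κ, compKer (codiffKer κ) (dzKer κ) x y := by
  funext x y
  exact (sum_compKer_codiffKer_dzKer x y).symm

/-- [folklore] The rows of `dzKer κ` are absolutely summable with sum `≤ 2`. -/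
theorem rowBound_dzKer {d : ℕ} (κ : Fin d) : RowBound (dzKer (d := d) κ) 2 := by
  intro x
  have h1 : Summable fun w : X d => (if w = x + unitVec κ then (1 : ℝ) else 0) :=
    summable_of_ne_finset_zero (s := {x + unitVec κ}) fun w hw => by rw [Finset.mem_singleton] at hw; rw [if_neg hw]
  have h2 : Summable fun w : X d => (if w = x then (1 : ℝ) else 0) :=
    summable_of_ne_finset_zero (s := {x}) fun w hw => by rw [Finset.mem_singleton] at hw; rw [if_neg hw]
  refine ⟨(summable_dzKer_row κ x).abs, ((summable_dzKer_row κ x).abs.tsum_le_tsum (fun w => ?_) (h1.add h2)).trans_eq ?_⟩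
  · simp only [dzKer]; split_ifs <;> simp
  · rw [h1.tsum_add h2, tsum_ite_eq, tsum_ite_eq]; norm_num

/-- [folklore] **`(Dhat 4 s)ᵀ · Dhat 4 s = L̂`** — the real fine-torus gradient matrix squares to `PeriodisedProjector.Lhat s` (= the periodised positive scalar
Laplacian `(lapKer)^`) on every fine torus: the `ĝradᵀĝrad = L̂` of K-TB3b FILE 2 §2 (`tauP·What0 = Nhatᵀ·L̂·L̂·Nhat`). -/
theorem Dhat_transpose_mul_Dhat (s : ℕ) [NeZero s] : (Dhat 4 s)ᵀ * Dhat 4 s = Lhat s := by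
  ext z y
  rw [Matrix.mul_apply, Fintype.sum_prod_type_right, Lhat_apply, lapKer_eq_sum_compKer (d := 4),
    periodise₂_finset_sum Finset.univ (fun κ => compKer (codiffKer κ) (dzKer κ))
      (fun κ _ x => (summable_abs_compKer (summable_codiffKer_row κ x).abs (rowBound_dzKer κ)).1.of_abs)]
  refine Finset.sum_congr rfl fun κ _ => ?_
  have h := periodise₂_compKer_matrix (s := s) (fun x => (summable_codiffKer_row (d := 4) κ x).abs) (isPeriodic₂_dzKer κ s) (rowBound_dzKer κ)
  have hzy := congr_fun (congr_fun h z) y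
  rw [Matrix.of_apply, Matrix.mul_apply] at hzy
  exact (hzy.trans (Finset.sum_congr rfl fun x _ => by rw [Matrix.of_apply, Matrix.of_apply, Dhat_transpose_apply, Dhat_apply])).symm

/-- [folklore] **`DhatSᵀ · DhatS = L̂`** in the sorted currency (re-indexing the summed bond index by the equivalence `e₁` changes nothing). -/
theorem DhatS_transpose_mul_DhatS : (DhatS m p)ᵀ * DhatS m p = Lhat ((m + 1) * p) := by
  rw [DhatS, Matrix.transpose_submatrix, ← Matrix.submatrix_mul _ _ id (e₁ (m + 1) p) id (e₁ (m + 1) p).bijective, Matrix.submatrix_id_id,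
    Dhat_transpose_mul_Dhat]

end Road

end Summit.QuantumFields.BalabanUV.Beta.D1BFx.TorusHodgeWeight

end
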